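import Summits.RiemannHypothesis.RiemannHypothesis.Theorems.WeilGroundStateMarkovPartPositiveGroundStatePositive
import Summits.RiemannHypothesis.RiemannHypothesis.Theorems.WeilGroundStateMarkovPartPositiveGroundStatePhase
import Summits.RiemannHypothesis.RiemannHypothesis.Theorems.WeilGroundStateMarkovPartPositiveGroundStateDensity

/-!
# Markov part of Weil's form: every ground state is a phase multiple of the positive one

Support file for item `MarkovPartPositiveGroundState` of route `WeilGroundState`; the last three
bookkeeping steps before the assembly.

* `exists_even_pos_rep`: an a.e. positive (on the window), a.e. even `Φ ≥ 0` has a representative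
  which is pointwise even and pointwise positive on the open window.
* `minimizer_ae_eq_const_mul`: given the non-negative normalised minimiser `Φ` (unique, a.e.
  positive), every normalised finite-energy `u` of the window with `𝓔_a(u) ≤ E` is `γΦ` a.e. for a
  constant `|γ| = 1` (`|u|` is a non-negative minimiser, hence `= Φ`; then phase rigidity).
* `tendsto_phase_fix`: if `gₙ → γu` in `L²` (`|γ| = 1`, `∫|u|² = 1`), the explicitly phase-corrected
  sequence `cₙ gₙ`, `cₙ = conj⟨gₙ, u⟩/|⟨gₙ, u⟩|`, converges to `u` in `L²`.
-/

-- `Summit.RiemannHypothesis.RiemannHypothesis.…` repeats the summit name by design (D-0017 layout).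
set_option linter.dupNamespace false

noncomputable section

open MeasureTheory Set Filter
open scoped Topology ENNReal NNReal ComplexConjugate

namespace Summit.RiemannHypothesis.RiemannHypothesis.Theorems.WeilGroundStateMarkovPart

open Literature.NumberTheory.LFunctions Literature.NumberTheory.LFunctions.ConnesVanSuijlekom
open Summit.RiemannHypothesis.RiemannHypothesis.Theorems.WeilWindowFlowWindowLipschitz

/-! ## An even, positive representative -/

/-- **Choice of representative.** If `Φ` vanishes off `[-a, a]`, is a.e. positive on `(-a, a)` and
a.e. even, then some `f` in its a.e. class is even everywhere and positive everywhere on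
`(-a, a)`. -/
theorem exists_even_pos_rep {a : ℝ} {Φ : ℝ → ℝ} (hs : ∀ x, x ∉ Icc (-a) a → Φ x = 0)
    (hpos : ∀ᵐ x : ℝ, x ∈ Ioo (-a) a → 0 < Φ x) (heven : Φ =ᵐ[volume] fun x ↦ Φ (-x)) :
    ∃ f : ℝ → ℝ, (∀ x, f (-x) = f x) ∧ (∀ x ∈ Ioo (-a) a, 0 < f x) ∧ f =ᵐ[volume] Φ := by
  classical
  set f : ℝ → ℝ := fun x ↦ if x ∈ Ioo (-a) a then
    (if 0 < max (Φ x) (Φ (-x)) then max (Φ x) (Φ (-x)) else 1) else 0 with hfdef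
  have hmem : ∀ x, (-x ∈ Ioo (-a) a) ↔ (x ∈ Ioo (-a) a) := fun x ↦ by
    constructor <;> rintro ⟨h1, h2⟩ <;> exact ⟨by linarith, by linarith⟩
  refine ⟨f, fun x ↦ ?_, fun x hx ↦ ?_, ?_⟩
  · simp only [hfdef, hmem x, neg_neg, max_comm (Φ (-x)) (Φ x)]
  · simp only [hfdef, if_pos hx]
    split_ifs with h
    · exact h
    · exact one_pos
  · filter_upwards [hpos, heven, Measure.ae_ne volume a, Measure.ae_ne volume (-a)] with x hx he
      hxa hxa'
    by_cases hxI : x ∈ Ioo (-a) a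
    · have hp := hx hxI
      have he' : Φ (-x) = Φ x := he.symm
      have hmax : max (Φ x) (Φ (-x)) = Φ x := by rw [he', max_self]
      simp only [hfdef, if_pos hxI, hmax, if_pos hp]
    · have hxI' : x ∉ Icc (-a) a := fun h ↦ hxI ⟨lt_of_le_of_ne h.1 (Ne.symm hxa'),
        lt_of_le_of_ne h.2 hxa⟩
      simp only [hfdef, if_neg hxI, hs x hxI']

/-! ## Every ground state is `γ Φ` -/

/-- **Every normalised minimiser is a unit multiple of the positive one.** Let `E` be the bottom of
`𝓔_a` on the form domain of the window (`E ∫|v|² ≤ 𝓔_a(v)` there, `a > 0`) and `Φ ≥ 0` measurable,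
vanishing off `[-a, a]`, `∫ Φ² = 1`, of finite archimedean energy, `𝓔_a(Φ) ≤ E` and a.e. positive on
`(-a, a)`. Then every `u ∈ L²`, a.e. zero off `[-a, a]`, with `∫|u|² = 1`, finite archimedean energy
and `𝓔_a(u) ≤ E` satisfies `u = γΦ` a.e. for some constant `|γ| = 1` (`|u|` is a non-negative
normalised minimiser, equal to `Φ` by uniqueness; then phase rigidity). -/
theorem minimizer_ae_eq_const_mul {a E : ℝ} (ha : 0 < a) {Φ : ℝ → ℝ}
    (hm : Measurable Φ) (h0 : ∀ x, 0 ≤ Φ x) (hL : MemLp Φ 2)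
    (hs : ∀ x, x ∉ Icc (-a) a → Φ x = 0) (hn : ∫ x, Φ x ^ 2 = 1)
    (hfin : IntegrableOn (fun t ↦ weilArchDensity t * weilIncrement (fun x ↦ (Φ x : ℂ)) t)
      (Ioi 0))
    (hE : weilDirichletEnergy a (fun x ↦ (Φ x : ℂ)) ≤ E)
    (hbot : ∀ v : ℝ → ℂ, MemLp v 2 → (∀ x, x ∉ Icc (-a) a → v x = 0) →
      IntegrableOn (fun t ↦ weilArchDensity t * weilIncrement v t) (Ioi 0) →
      E * ∫ x, ‖v x‖ ^ 2 ≤ weilDirichletEnergy a v)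
    (hpos : ∀ᵐ x : ℝ, x ∈ Ioo (-a) a → 0 < Φ x)
    {u : ℝ → ℂ} (hu : MemLp u 2) (hus : ∀ᵐ x : ℝ, x ∉ Icc (-a) a → u x = 0)
    (hun : ∫ x, ‖u x‖ ^ 2 = 1)
    (hufin : IntegrableOn (fun t ↦ weilArchDensity t * weilIncrement u t) (Ioi 0))
    (huE : weilDirichletEnergy a u ≤ E) :
    ∃ γ : ℂ, ‖γ‖ = 1 ∧ u =ᵐ[volume] fun x ↦ γ * (Φ x : ℂ) := by
  -- a measurable representative with pointwise support
  set v : ℝ → ℂ := (Icc (-a) a).indicator (hu.1.mk u) with hvdef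
  have hvu : v =ᵐ[volume] u := by
    filter_upwards [hu.1.ae_eq_mk, hus] with x h1 h2
    by_cases hx : x ∈ Icc (-a) a
    · rw [hvdef, indicator_of_mem hx]; exact h1.symm
    · rw [hvdef, indicator_of_notMem hx, h2 hx]
  have hvm : Measurable v :=
    hu.1.stronglyMeasurable_mk.measurable.indicator measurableSet_Icc
  have hvL : MemLp v 2 := hu.ae_eq hvu.symm
  have hvs : ∀ x, x ∉ Icc (-a) a → v x = 0 := fun x hx ↦ indicator_of_notMem hx _
  have hvn : ∫ x, ‖v x‖ ^ 2 = 1 := by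
    rw [← hun]; exact integral_congr_ae (hvu.mono fun x hx ↦ by simp [hx])
  have hvfin : IntegrableOn (fun t ↦ weilArchDensity t * weilIncrement v t) (Ioi 0) := by
    simp only [weilIncrement_congr_ae hvu]; exact hufin
  have hvE : weilDirichletEnergy a v ≤ E := by rw [weilDirichletEnergy_congr_ae a hvu]; exact huE
  -- its modulus is a non-negative normalised minimiser
  set Ψ : ℝ → ℝ := fun x ↦ ‖v x‖ with hΨdef
  have hΨm : Measurable Ψ := hvm.norm
  have hΨL : MemLp Ψ 2 := hvL.norm
  have hΨs : ∀ x, x ∉ Icc (-a) a → Ψ x = 0 := fun x hx ↦ by simp [hΨdef, hvs x hx]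
  have hΨn : ∫ x, Ψ x ^ 2 = 1 := hvn
  have hΨfin := finiteEnergy_norm hvL hvfin
  have hΨE : weilDirichletEnergy a (fun x ↦ ((Ψ x : ℝ) : ℂ)) ≤ E :=
    (weilDirichletEnergy_norm_le a hvL hvfin).trans hvE
  have hΦΨ : Φ =ᵐ[volume] Ψ :=
    nonneg_minimizer_ae_eq hm hΨm h0 (fun x ↦ norm_nonneg _) hL hΨL hs hΨs hn hΨn hfin hΨfin
      hE hΨE hbot
  -- phase rigidity for `v`
  have hvpos : ∀ᵐ x : ℝ, x ∈ Ioo (-a) a → 0 < ‖v x‖ := by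
    filter_upwards [hpos, hΦΨ] with x hx he hxI
    have := hx hxI
    rwa [he] at this
  obtain ⟨γ, hγ, hvγ⟩ := phase_rigidity ha hvm hvL hvs hvn hvfin hvE hbot hvpos
  refine ⟨γ, hγ, ?_⟩
  filter_upwards [hvu, hvγ, hΦΨ] with x h1 h2 h3
  rw [← h1, h2, h3]

/-! ## Fixing the phase along a sequence -/

/-- **Fixing phases.** If `gₙ → γu` in `L²` with `|γ| = 1` and `∫|u|² = 1`, then with
`sₙ = ∫ gₙ ū` and the phase `cₙ = conj(sₙ)/|sₙ|` (`cₙ = 1` if `sₙ = 0`), `cₙ gₙ → u` in `L²`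
(`sₙ → γ`, `cₙ → conj γ`, and `cₙgₙ − u = cₙ(gₙ − γu) + (cₙγ − 1)u`). -/
theorem tendsto_phase_fix {u : ℝ → ℂ} {g : ℕ → ℝ → ℂ} {γ : ℂ} (hu : MemLp u 2)
    (hun : ∫ x, ‖u x‖ ^ 2 = 1) (hg : ∀ n, MemLp (g n) 2) (hγ : ‖γ‖ = 1)
    (hlim : Tendsto (fun n ↦ ∫ x, ‖g n x - γ * u x‖ ^ 2) atTop (𝓝 0)) :
    Tendsto (fun n ↦ ∫ x, ‖(if (∫ y, g n y * conj (u y)) = 0 then (1 : ℂ)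
        else conj (∫ y, g n y * conj (u y)) / (((‖∫ y, g n y * conj (u y)‖ : ℝ)) : ℂ)) * g n x -
          u x‖ ^ 2) atTop (𝓝 0) := by
  classical
  set s : ℕ → ℂ := fun n ↦ ∫ y, g n y * conj (u y) with hsdef
  set c : ℕ → ℂ := fun n ↦ if s n = 0 then (1 : ℂ) else conj (s n) / (((‖s n‖ : ℝ)) : ℂ)
    with hcdef
  have hγ0 : γ ≠ 0 := fun h ↦ by rw [h, norm_zero] at hγ; exact zero_ne_one hγ
  have hcn : ∀ n, ‖c n‖ = 1 := fun n ↦ by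
    simp only [hcdef]
    split_ifs with h
    · exact norm_one
    · rw [norm_div, Complex.norm_conj, Complex.norm_real, Real.norm_of_nonneg (norm_nonneg _),
        div_self (norm_ne_zero_iff.2 h)]
  -- `s n → γ`
  have hF : MemLp (fun x ↦ γ * u x) 2 := hu.const_mul γ
  have hs : Tendsto s atTop (𝓝 γ) := by
    have h := tendsto_integral_mul_conj_left hu hF hg hlim
    have e : ∫ x, γ * u x * conj (u x) = γ := by
      have : (fun x ↦ γ * u x * conj (u x)) = fun x ↦ γ * (u x * conj (u x)) := by
        funext x; ring
      rw [this, integral_const_mul, integral_mul_conj_self, hun]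
      simp
    rwa [e] at h
  -- `c n → conj γ`
  have hc : Tendsto c atTop (𝓝 (conj γ)) := by
    have hev : ∀ᶠ n in atTop, s n ≠ 0 := hs.eventually_ne hγ0
    have h1 : Tendsto (fun n ↦ conj (s n) / (((‖s n‖ : ℝ)) : ℂ)) atTop (𝓝 (conj γ)) := by
      have hnum : Tendsto (fun n ↦ conj (s n)) atTop (𝓝 (conj γ)) :=
        (Complex.continuous_conj.tendsto γ).comp hs
      have hden : Tendsto (fun n ↦ (((‖s n‖ : ℝ)) : ℂ)) atTop (𝓝 (((‖γ‖ : ℝ)) : ℂ)) :=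
        ((Complex.continuous_ofReal.comp continuous_norm).tendsto γ).comp hs
      have h := hnum.div hden (by rw [hγ]; simp)
      rwa [hγ, Complex.ofReal_one, div_one] at h
    refine h1.congr' ?_
    filter_upwards [hev] with n hn
    simp only [hcdef, if_neg hn]
  -- the bound `∫|c g − u|² ≤ 2∫|g − γu|² + 2|cγ − 1|²`
  have hb : ∀ n, ∫ x, ‖c n * g n x - u x‖ ^ 2 ≤
      2 * (∫ x, ‖g n x - γ * u x‖ ^ 2) + 2 * ‖c n * γ - 1‖ ^ 2 := by
    intro n
    have hA : MemLp (fun x ↦ c n * (g n x - γ * u x)) 2 := ((hg n).sub hF).const_mul (c n)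
    have hB : MemLp (fun x ↦ (c n * γ - 1) * u x) 2 := hu.const_mul _
    have h := integral_norm_sq_add_le hA hB
    have e1 : (fun x ↦ ‖c n * (g n x - γ * u x) + (c n * γ - 1) * u x‖ ^ 2) =
        fun x ↦ ‖c n * g n x - u x‖ ^ 2 := by
      funext x; ring_nf
    have e2 : ∫ x, ‖c n * (g n x - γ * u x)‖ ^ 2 = ∫ x, ‖g n x - γ * u x‖ ^ 2 :=
      integral_congr_ae (Eventually.of_forall fun x ↦ by
        simp only [norm_mul, hcn n, one_mul])
    have e3 : ∫ x, ‖(c n * γ - 1) * u x‖ ^ 2 = ‖c n * γ - 1‖ ^ 2 := by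
      have : (fun x ↦ ‖(c n * γ - 1) * u x‖ ^ 2) = fun x ↦ ‖c n * γ - 1‖ ^ 2 * ‖u x‖ ^ 2 := by
        funext x; rw [norm_mul, mul_pow]
      rw [this, integral_const_mul, hun, mul_one]
    rw [e1, e2, e3] at h
    exact h
  have hlim2 : Tendsto (fun n ↦ 2 * (∫ x, ‖g n x - γ * u x‖ ^ 2) + 2 * ‖c n * γ - 1‖ ^ 2)
      atTop (𝓝 0) := by
    have h1 : Tendsto (fun n ↦ ‖c n * γ - 1‖ ^ 2) atTop (𝓝 0) := by
      have h := ((hc.mul_const γ).sub_const 1).norm.pow 2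
      have e : conj γ * γ - 1 = 0 := by
        rw [mul_comm, Complex.mul_conj, Complex.normSq_eq_norm_sq, hγ]; simp
      rw [e, norm_zero, zero_pow two_ne_zero] at h
      exact h
    simpa using (hlim.const_mul 2).add (h1.const_mul 2)
  exact squeeze_zero (fun n ↦ integral_nonneg fun _ ↦ by positivity) hb hlim2

end Summit.RiemannHypothesis.RiemannHypothesis.Theorems.WeilGroundStateMarkovPart

end
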